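import Literature.MathematicalPhysics.QuantumLattice.HubbardHighTemperatureTwoPoint
import Literature.MathematicalPhysics.QuantumLattice.HubbardFermiLiquidBoundProofs
import HarnessLib

/-!
# Exponential decay of the Hubbard two-point function at high temperature

Continuation of `HubbardHighTemperatureTwoPoint.lean` (the high-temperature corner of the fact
`bgm_two_point_limit`: for `0 ≤ β ≤ β₀ = SourceGas.betaHT` and ALL real `U, μ` the torus two-point
functions `⟨c†_{xσ} c_{yσ'}⟩_{β,L}` converge as `L → ∞`). Here the same polymer expansion gives
Ueltschi's exponential clustering (Thm. 2.1 (iii) of Ueltschi 1999) for this observable: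

* `SourceGas.norm_hubbardThermalTwoPoint_le_exp_neg` — for `0 ≤ β ≤ β₀`, all real `U, μ`, every
  torus side `L ≥ 1` and all `x, y, σ, σ'`,
  `|⟨c†_{xσ} c_{yσ'}⟩_{β,L}| ≤ (4/β₀) e^{-(d_L(y - x) + 1)}`, `d_L` the sup-norm distance on the torus;
* `norm_lim_hubbardThermalTwoPoint_le_exp_neg` — hence every thermodynamic limit `S` of
  `⟨c†_{xσ} c_{yσ'}⟩_{β,L}` satisfies `|S| ≤ (4/β₀) e^{-(‖y - x‖_∞ + 1)}`.

## The argument (Ueltschi 1999, proof of Thm. 2.1 (ii)–(iii), for the source gas of the previous file)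

With the source `ε c†_{0̄σ} c_{ȳσ}` on the bond `b₀ = (0̄, ȳ, σ)`, `⟨c†_{0̄σ}c_{ȳσ}⟩_{β,L} = F'(0)` for
`F(ε) = log Ξ(ρ^ε)` (`deriv_srcLogZ_torus`), and `F(ε) - F(0) = main_R(ε) + tail_R(ε)` with
`|tail_R| ≤ e^{-R}` on `|ε| ≤ β₀` (`srcLogZ_sub_eq_main_add_tail`, `norm_srcTail_le`), the main part
collecting the anchored families of total size `< R`. NEW HERE: **`main_R'(0) = 0` for
`R ≤ d_L(ȳ) + 1`**. Indeed a polymer `A` of size `≤ d_L(ȳ)` cannot contain a hopping path from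
`0̄` to `ȳ` (heights along nearest-neighbour steps grow by at most one:
`height_succ_le_card_of_reflTransGen`), so in every term `Z(c · 1_{K'})` of its activity
(`couplingWeight_eq_sum`) the hopping bonds of `K'` do not connect the component `S ∋ 0̄` to `ȳ`;
the Koma–Tasaki gauge transformation `e^{-N_S}` (`gaugeMatrix` of the indicator of `S`) then
commutes with the weight `exp(-βV + Σ_{K'} c T)` and rescales the source observable `T_{b₀}` by
`e^{-1} ≠ 1`, whence `Tr(e^{-βV + Σ c T} T_{b₀}) = 0` (`trace_weight_mul_eq_zero_of_conj_eq_smul`),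
i.e. `d/dε Z(c^ε · 1_{K'})|₀ = 0` (`deriv_Zc_add_smul_single_zero`): **disconnected sources have no
linear response**. So every activity of a small polymer has vanishing `ε`-derivative at `0`, hence
so do the polymer partition functions of small families (product rule), their Kotecký–Preiss
logarithms (`exp ∘ log Z = Z` near `0`), the truncated functionals, and `main_R`. Therefore
`⟨c†_{0̄σ}c_{ȳσ}⟩_{β,L} = tail_R'(0)`, which Cauchy's estimate on `|ε| = β₀/2` bounds by
`2e^{-R}/(β₀/2)`.

## References

* D. Ueltschi, *Analyticity in Hubbard models*, J. Stat. Phys. 95 (1999) 693, Thm. 2.1 (iii)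
  (exponential clustering for `β‖T‖ < const`) and its proof. [Ueltschi1999]
* R. Kotecký, D. Preiss, Commun. Math. Phys. 103 (1986) 491, estimate (4). [KoteckyPreiss1986]
* T. Koma, H. Tasaki, PRL 68 (1992) 3248, eqs. (5)–(8) (the gauge transformation). [KomaTasakiPRL1992]
* G. Benfatto, A. Giuliani, V. Mastropietro, Ann. Henri Poincaré 7 (2006) 809, Thm. 1.1 (the fact;
  this file covers its high-temperature corner only). [BenfattoGiulianiMastropietro2006]
-/

noncomputable section

namespace Literature.MathematicalPhysics.QuantumLattice

open Matrix Finset HubbardWave0 Literature.Probability.LatticeModels Filter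
open scoped _root_.Topology

/-! ### The gauge transformation of a set of sites and the selection rule for disconnected sources -/

section SubsetGauge

variable {Λ : Type*} [LinearOrder Λ] [Fintype Λ]

/-- The Koma–Tasaki potential `θ = 1` on the orbitals of the sites of `S`, `0` elsewhere. [cite: KomaTasakiPRL1992, eq. (5)] -/
def subsetPotential (S : Finset Λ) : Orb Λ → ℝ := fun o => if (ofLex o).1 ∈ S then 1 else 0

omit [Fintype Λ] in
/-- `θ_S(x, σ) = 1_S(x)`. [folklore] -/
theorem subsetPotential_orb (S : Finset Λ) (x : Λ) (σ : Fin 2) :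
    subsetPotential S (orb x σ) = if x ∈ S then 1 else 0 := rfl

/-- Conjugating a hopping monomial `c†_i c_j` by the gauge transformation rescales it by
`e^{-θ_i + θ_j}`. [cite: KomaTasakiPRL1992, eqs. (7)–(8)] -/
theorem gaugeMatrix_conj_creation_mul_annihilation (θ : Orb Λ → ℝ) (i j : Orb Λ) :
    gaugeMatrix θ * (creation i * annihilation j) * gaugeMatrix (-θ) =
      ((Real.exp (-θ i + θ j) : ℝ) : ℂ) • (creation i * annihilation j) := by
  rw [gaugeMatrix_conj_mul, gaugeMatrix_mul_creation_mul, gaugeMatrix_mul_annihilation_mul, smul_mul_smul,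
    ← Complex.ofReal_mul, ← Real.exp_add]

/-- The hopping operator of a bond not crossing `∂S` is invariant under the gauge transformation of `S`.
[cite: KomaTasakiPRL1992, eqs. (7)–(8)] -/
theorem gaugeMatrix_subset_conj_bondOp {S : Finset Λ} {b : Bond Λ} (hb : b.1 ∈ S ↔ b.2.1 ∈ S) :
    gaugeMatrix (subsetPotential S) * bondOp b * gaugeMatrix (-subsetPotential S) = bondOp b := by
  rw [bondOp, gaugeMatrix_conj_creation_mul_annihilation, subsetPotential_orb, subsetPotential_orb]
  have h0 : -(if b.1 ∈ S then (1 : ℝ) else 0) + (if b.2.1 ∈ S then (1 : ℝ) else 0) = 0 := by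
    by_cases h1 : b.1 ∈ S
    · rw [if_pos h1, if_pos (hb.1 h1)]; ring
    · rw [if_neg h1, if_neg (fun h2 => h1 (hb.2 h2))]; ring
  rw [h0, Real.exp_zero, Complex.ofReal_one, one_smul]

/-- Number operators are gauge invariant. [cite: KomaTasakiPRL1992, eq. (7)] -/
theorem gaugeMatrix_conj_numberOp (θ : Orb Λ → ℝ) (x : Λ) (σ : Fin 2) :
    gaugeMatrix θ * numberOp x σ * gaugeMatrix (-θ) = numberOp x σ := by
  rw [← numberAt_orb, gaugeMatrix_mul_numberAt_mul]

/-- On-site operators are gauge invariant. [cite: KomaTasakiPRL1992, eq. (7)] -/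
theorem gaugeMatrix_conj_onSiteOp (θ : Orb Λ → ℝ) (U μ : ℂ) (x : Λ) :
    gaugeMatrix θ * onSiteOp U μ x * gaugeMatrix (-θ) = onSiteOp U μ x := by
  rw [onSiteOp, Matrix.mul_sub, Matrix.sub_mul, Matrix.mul_smul, Matrix.smul_mul, Matrix.mul_smul, Matrix.smul_mul,
    gaugeMatrix_conj_mul, gaugeMatrix_conj_numberOp, gaugeMatrix_conj_numberOp, Matrix.mul_add, Matrix.add_mul,
    gaugeMatrix_conj_numberOp, gaugeMatrix_conj_numberOp]

/-- On-site sums are gauge invariant. [cite: KomaTasakiPRL1992, eq. (7)] -/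
theorem gaugeMatrix_conj_onSiteSum (θ : Orb Λ → ℝ) (U μ : ℂ) (A : Finset Λ) :
    gaugeMatrix θ * onSiteSum U μ A * gaugeMatrix (-θ) = onSiteSum U μ A := by
  rw [onSiteSum, Finset.mul_sum, Finset.sum_mul]
  exact Finset.sum_congr rfl fun x _ => gaugeMatrix_conj_onSiteOp θ U μ x

/-- **A hopping operator whose bonds do not cross `∂S` is invariant under the gauge transformation
of `S`.** [cite: KomaTasakiPRL1992, eqs. (7)–(8)] -/
theorem gaugeMatrix_subset_conj_hopSum {S : Finset Λ} {c : Bond Λ → ℂ} (hc : ∀ b, c b ≠ 0 → (b.1 ∈ S ↔ b.2.1 ∈ S)) :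
    gaugeMatrix (subsetPotential S) * hopSum c * gaugeMatrix (-subsetPotential S) = hopSum c := by
  rw [hopSum, Finset.mul_sum, Finset.sum_mul]
  refine Finset.sum_congr rfl fun b _ => ?_
  by_cases hb : c b = 0
  · rw [hb, zero_smul, Matrix.mul_zero, Matrix.zero_mul]
  · rw [Matrix.mul_smul, Matrix.smul_mul, gaugeMatrix_subset_conj_bondOp (hc b hb)]

/-- Hence the gauge transformation of `S` commutes with the generalised Hamiltonian
`-βV + Σ c T` of such couplings. [cite: KomaTasakiPRL1992, eqs. (7)–(8)] -/
theorem commute_gaugeMatrix_subset {S : Finset Λ} {c : Bond Λ → ℂ} (hc : ∀ b, c b ≠ 0 → (b.1 ∈ S ↔ b.2.1 ∈ S)) (β U μ : ℂ) :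
    Commute (gaugeMatrix (subsetPotential S)) (-(β • onSiteSum U μ (Finset.univ : Finset Λ)) + hopSum c) := by
  set θ := subsetPotential S
  have hconj : gaugeMatrix θ * (-(β • onSiteSum U μ (Finset.univ : Finset Λ)) + hopSum c) * gaugeMatrix (-θ) =
      -(β • onSiteSum U μ (Finset.univ : Finset Λ)) + hopSum c := by
    rw [Matrix.mul_add, Matrix.add_mul, gaugeMatrix_subset_conj_hopSum hc, Matrix.mul_neg, Matrix.neg_mul, Matrix.mul_smul,
      Matrix.smul_mul, gaugeMatrix_conj_onSiteSum]
  have h := congrArg (· * gaugeMatrix θ) hconj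
  simp only [Matrix.mul_assoc, gaugeMatrix_neg_mul_gaugeMatrix, Matrix.mul_one] at h
  exact h

/-- **Disconnected sources have no linear response.** If the couplings `c` do not cross `∂S` and the
bond `b₀` does (`b₀.1 ∈ S`, `b₀.2 ∉ S`), then `Tr(exp(-βV + Σ c T) T_{b₀}) = 0`: the gauge
transformation of `S` commutes with the weight and rescales `T_{b₀} = c†_{b₀.1} c_{b₀.2}` by `e^{-1} ≠ 1`.
[cite: Ueltschi1999, proof of Thm. 2.1 (iii); KomaTasakiPRL1992, eqs. (5)–(8)] -/
theorem trace_exp_mul_bondOp_eq_zero {S : Finset Λ} {c : Bond Λ → ℂ} (hc : ∀ b, c b ≠ 0 → (b.1 ∈ S ↔ b.2.1 ∈ S))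
    {b₀ : Bond Λ} (h1 : b₀.1 ∈ S) (h2 : b₀.2.1 ∉ S) (β U μ : ℂ) :
    (NormedSpace.exp (-(β • onSiteSum U μ (Finset.univ : Finset Λ)) + hopSum c) * bondOp b₀).trace = 0 := by
  refine trace_weight_mul_eq_zero_of_conj_eq_smul (P := gaugeMatrix (subsetPotential S)) (P' := gaugeMatrix (-subsetPotential S))
    (c := ((Real.exp (-1) : ℝ) : ℂ)) (commute_gaugeMatrix_subset hc β U μ).exp_right (gaugeMatrix_neg_mul_gaugeMatrix _) ?_ ?_
  · rw [bondOp, gaugeMatrix_conj_creation_mul_annihilation, subsetPotential_orb, subsetPotential_orb, if_pos h1, if_neg h2, add_zero]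
  · rw [Ne, Complex.ofReal_eq_one, Real.exp_eq_one_iff]
    norm_num

/-- In derivative form: `d/dε Zc(c + ε δ_{b₀})|₀ = 0` for couplings not crossing `∂S` and a source
bond crossing it. [cite: Ueltschi1999, proof of Thm. 2.1 (iii)] -/
theorem hasDerivAt_Zc_add_smul_single_zero_of_subset {S : Finset Λ} {c : Bond Λ → ℂ}
    (hc : ∀ b, c b ≠ 0 → (b.1 ∈ S ↔ b.2.1 ∈ S)) {b₀ : Bond Λ} (h1 : b₀.1 ∈ S) (h2 : b₀.2.1 ∉ S) (β U μ : ℂ) :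
    HasDerivAt (fun ε : ℂ => Zc β U μ (c + ε • (Pi.single b₀ 1 : Bond Λ → ℂ))) 0 0 := by
  have h := hasDerivAt_Zc_add_smul_single β U μ c b₀ 0
  rw [zero_smul, add_zero, trace_mul_comm, trace_exp_mul_bondOp_eq_zero hc h1 h2] at h
  exact h

end SubsetGauge

namespace SourceGas

/-! ### Small polymers do not respond linearly to the source -/

section Generic

variable {Λ : Type*} [LinearOrder Λ] [Fintype Λ]
variable {G : SimpleGraph Λ} [DecidableRel G.Adj] {β U μ : ℝ} {b₀ : Bond Λ}

omit [Fintype Λ] in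
/-- Restriction of couplings is additive. [folklore] -/
theorem couplingRestrict_add (c c' : Bond Λ → ℂ) (K : Finset (Bond Λ)) :
    couplingRestrict (c + c') K = couplingRestrict c K + couplingRestrict c' K := by
  funext b
  simp only [couplingRestrict_apply, Pi.add_apply]
  split_ifs <;> simp

omit [Fintype Λ] in
/-- Restriction of couplings is homogeneous. [folklore] -/
theorem couplingRestrict_smul (ε : ℂ) (c : Bond Λ → ℂ) (K : Finset (Bond Λ)) :
    couplingRestrict (ε • c) K = ε • couplingRestrict c K := by
  funext b
  simp only [couplingRestrict_apply, Pi.smul_apply, smul_eq_mul]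
  split_ifs <;> simp

omit [Fintype Λ] in
/-- Restricting the unit source `δ_{b₀}`: itself if `b₀ ∈ K`, zero otherwise. [folklore] -/
theorem couplingRestrict_single [DecidableEq Λ] (b₀ : Bond Λ) (K : Finset (Bond Λ)) :
    couplingRestrict (Pi.single b₀ 1 : Bond Λ → ℂ) K = if b₀ ∈ K then (Pi.single b₀ 1 : Bond Λ → ℂ) else 0 := by
  funext b
  rw [couplingRestrict_apply]
  by_cases hb : b = b₀
  · subst hb
    split_ifs <;> simp
  · rw [Pi.single_eq_of_ne hb]
    split_ifs <;> simp [Pi.single_eq_of_ne hb]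

omit [Fintype Λ] in
/-- The restricted source couplings: `c^ε · 1_{K'} = (β 1_G) · 1_{K'} + ε [b₀ ∈ K'] δ_{b₀}`. [folklore] -/
theorem couplingRestrict_srcCoupling_eq_add (ε : ℂ) (K : Finset (Bond Λ)) :
    couplingRestrict (srcCoupling G β b₀ ε) K =
      couplingRestrict (hubbardCoupling G (β : ℂ)) K + ε • (if b₀ ∈ K then (Pi.single b₀ 1 : Bond Λ → ℂ) else 0) := by
  rw [srcCoupling, couplingRestrict_add, couplingRestrict_smul, couplingRestrict_single]

omit [Fintype Λ] in
/-- The restricted hopping couplings only charge `G`-edges of `K'`: if `(β 1_G · 1_{K'})(b) ≠ 0` then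
`b ∈ K'` and `b` is an edge of `G`. [folklore] -/
theorem mem_and_adj_of_couplingRestrict_hubbardCoupling_ne_zero {K : Finset (Bond Λ)} {b : Bond Λ}
    (h : couplingRestrict (hubbardCoupling G (β : ℂ)) K b ≠ 0) : b ∈ K ∧ G.Adj b.1 b.2.1 := by
  rw [couplingRestrict_apply] at h
  by_cases hb : b ∈ K
  · rw [if_pos hb, hubbardCoupling] at h
    by_cases hadj : G.Adj b.1 b.2.1
    · exact ⟨hb, hadj⟩
    · rw [if_neg hadj] at h; exact absurd rfl h
  · rw [if_neg hb] at h; exact absurd rfl h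

omit [Fintype Λ] [DecidableRel G.Adj] in
/-- **No hopping path from `0̄` to `ȳ` inside a small polymer.** Let `ht` grow by at most one along
the edges of `G` and vanish at `b₀.1`. If `A` has at most `ht(b₀.2)` sites, `b₀.1 ∈ A`, and `S` is the
set of sites of `A` reachable from `b₀.1` along edges of `G` inside `A`, then `b₀.1 ∈ S`, `b₀.2 ∉ S`,
and every edge of `G` with both endpoints in `A` has both or none of its endpoints in `S`.
[cite: Ueltschi1999, proof of Thm. 2.1 (iii) (supports of size < d)] -/
theorem reach_properties {ht : Λ → ℕ} (hlip : ∀ a b, G.Adj a b → ht b ≤ ht a + 1) (h0 : ht b₀.1 = 0)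
    {A : Finset Λ} (hA : A.card ≤ ht b₀.2.1) (h1 : b₀.1 ∈ A) {S : Finset Λ}
    (hS : ∀ a, a ∈ S ↔ a ∈ A ∧ Relation.ReflTransGen (fun p q => G.Adj p q ∧ p ∈ A ∧ q ∈ A) b₀.1 a) :
    b₀.1 ∈ S ∧ b₀.2.1 ∉ S ∧ ∀ b : Bond Λ, G.Adj b.1 b.2.1 → b.1 ∈ A → b.2.1 ∈ A → (b.1 ∈ S ↔ b.2.1 ∈ S) := by
  classical
  refine ⟨(hS _).2 ⟨h1, Relation.ReflTransGen.refl⟩, fun hy => ?_, fun b hadj hb1 hb2 => ?_⟩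
  · have hreach := ((hS _).1 hy).2
    have hcard := height_succ_le_card_of_reflTransGen (R := G.Adj) (S := A) hlip h1 h0 hreach
    omega
  · constructor
    · intro h
      exact (hS _).2 ⟨hb2, ((hS _).1 h).2.tail ⟨hadj, hb1, hb2⟩⟩
    · intro h
      exact (hS _).2 ⟨hb1, ((hS _).1 h).2.tail ⟨hadj.symm, hb2, hb1⟩⟩

omit [LinearOrder Λ] [Fintype Λ] in
/-- Sums of functions with vanishing derivative have vanishing derivative. [folklore] -/
theorem hasDerivAt_sum_zero {ι : Type*} {s : Finset ι} {f : ι → ℂ → ℂ} {x : ℂ} (h : ∀ i ∈ s, HasDerivAt (f i) 0 x) :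
    HasDerivAt (fun ε => ∑ i ∈ s, f i ε) 0 x := by
  have := HasDerivAt.fun_sum h
  rwa [Finset.sum_const_zero] at this

/-- **Small polymers have no linear response**: if `ht` grows by at most one along the edges of `G`,
`ht(b₀.1) = 0` and `|A| ≤ ht(b₀.2)`, then `d/dε ρ^ε(A)|₀ = 0` for the source-gas activity.
[cite: Ueltschi1999, proof of Thm. 2.1 (iii)] -/
theorem hasDerivAt_srcActivity_zero {ht : Λ → ℕ} (hlip : ∀ a b, G.Adj a b → ht b ≤ ht a + 1) (h0 : ht b₀.1 = 0)
    {A : Finset Λ} (hA : A.card ≤ ht b₀.2.1) :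
    HasDerivAt (fun ε : ℂ => srcActivity G β U μ b₀ ε A) 0 0 := by
  classical
  simp only [srcActivity, couplingActivity_apply, couplingWeight_eq_sum]
  refine hasDerivAt_sum_zero fun X hX => hasDerivAt_sum_zero fun K hK => ?_
  have hKX : K ⊆ X := Finset.mem_powerset.1 hK
  obtain ⟨-, hXA⟩ := Finset.mem_filter.1 hX
  simp_rw [couplingRestrict_srcCoupling_eq_add]
  by_cases hb₀ : b₀ ∈ K
  · -- the source bond is charged: both its sites lie in `A`
    simp only [if_pos hb₀]
    have hvert : b₀.1 ∈ A ∧ b₀.2.1 ∈ A := by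
      have := endpoints_mem_cellSupp (hKX hb₀)
      rw [hXA] at this
      exact this
    set S : Finset Λ := A.filter fun a => Relation.ReflTransGen (fun p q => G.Adj p q ∧ p ∈ A ∧ q ∈ A) b₀.1 a with hSdef
    have hSmem : ∀ a, a ∈ S ↔ a ∈ A ∧ Relation.ReflTransGen (fun p q => G.Adj p q ∧ p ∈ A ∧ q ∈ A) b₀.1 a := fun a => by
      rw [hSdef, Finset.mem_filter]
    obtain ⟨hS1, hS2, hS⟩ := reach_properties (G := G) hlip h0 hA hvert.1 hSmem
    have hc : ∀ b, couplingRestrict (hubbardCoupling G (β : ℂ)) K b ≠ 0 → (b.1 ∈ S ↔ b.2.1 ∈ S) := by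
      intro b hb
      obtain ⟨hbK, hadj⟩ := mem_and_adj_of_couplingRestrict_hubbardCoupling_ne_zero hb
      have hbA : b.1 ∈ A ∧ b.2.1 ∈ A := by
        have := endpoints_mem_cellSupp (hKX hbK)
        rw [hXA] at this
        exact this
      exact hS b hadj hbA.1 hbA.2
    have hZ := hasDerivAt_Zc_add_smul_single_zero_of_subset hc hS1 hS2 (β : ℂ) (U : ℂ) (μ : ℂ)
    have hratio : HasDerivAt (fun ε : ℂ => gibbsRatio (β : ℂ) (U : ℂ) (μ : ℂ)
        (couplingRestrict (hubbardCoupling G (β : ℂ)) K + ε • (Pi.single b₀ 1 : Bond Λ → ℂ))) 0 0 := by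
      have := hZ.div_const (Zc (β : ℂ) (U : ℂ) (μ : ℂ) (0 : Bond Λ → ℂ))
      rw [zero_div] at this
      exact this
    have := hratio.const_mul ((-1 : ℂ) ^ (X \ K).card)
    rwa [mul_zero] at this
  · simp only [if_neg hb₀, smul_zero, add_zero]
    exact hasDerivAt_const _ _

/-! ### Hence small families have constant weight to first order -/

omit [LinearOrder Λ] [Fintype Λ] in
/-- **Product rule**: a polymer partition function whose activities all have vanishing derivative has
vanishing derivative. [folklore] -/
theorem hasDerivAt_polymerPartitionFunction_zero {P : Type*} [DecidableEq P] (inc : P → P → Prop) [DecidableRel inc]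
    {v : ℂ → P → ℂ} {B : Finset P} {ε₀ : ℂ} (hv : ∀ γ ∈ B, HasDerivAt (fun ε => v ε γ) 0 ε₀) :
    HasDerivAt (fun ε => polymerPartitionFunction inc (v ε) B) 0 ε₀ := by
  unfold polymerPartitionFunction
  refine hasDerivAt_sum_zero fun D hD => ?_
  have hDB : D ⊆ B := Finset.mem_powerset.1 hD
  by_cases hcomp : IsCompatible inc D
  · simp only [if_pos hcomp]
    have h := HasDerivAt.fun_finsetProd (u := D) (f := fun γ ε => v ε γ) (f' := fun _ => (0 : ℂ)) (x := ε₀)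
      fun γ hγ => hv γ (hDB hγ)
    simp only [smul_zero, Finset.sum_const_zero] at h
    exact h
  · simp only [if_neg hcomp]
    exact hasDerivAt_const _ _

/-- **The logarithm follows**: for `0 ≤ β ≤ β₀` and degrees `≤ 4`, if every polymer of the family
`B` has vanishing `ε`-derivative of its activity at `0`, then so has `log Z(B; ρ^ε)` (differentiate
`exp ∘ log Z = Z`, valid on `|ε| ≤ β₀`). [cite: KoteckyPreiss1986, p. 493 (analyticity of log Z)] -/
theorem hasDerivAt_polymerLogZ_srcActivity_zero [Countable Λ] (hdeg : ∀ v : Λ, (Finset.univ.filter (G.Adj v)).card ≤ 4)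
    (hβ0 : 0 ≤ β) (hβ : β ≤ betaHT) {B : Finset (Finset Λ)}
    (hB : ∀ A ∈ B, HasDerivAt (fun ε : ℂ => srcActivity G β U μ b₀ ε A) 0 0) :
    HasDerivAt (fun ε : ℂ => polymerLogZ polyInc (srcActivity G β U μ b₀ ε) B) 0 0 := by
  set Lg : ℂ → ℂ := fun ε => polymerLogZ polyInc (srcActivity G β U μ b₀ ε) B with hLg
  have hball : Metric.ball (0 : ℂ) betaHT ∈ 𝓝 (0 : ℂ) := Metric.ball_mem_nhds 0 betaHT_pos
  have hdiff : DifferentiableOn ℂ Lg (Metric.ball 0 betaHT) :=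
    differentiableOn_polymerLogZ_param (inc := polyInc) (v := fun ε A => srcActivity G β U μ b₀ ε A) B Metric.isOpen_ball
      (fun A _ => (differentiable_srcActivity A).differentiableOn) fun ε hε u hu =>
        polymerPartitionFunction_ray_ne_zero hdeg hβ0 hβ (le_of_lt (by simpa using hε)) hu _
  have hL : HasDerivAt Lg (deriv Lg 0) 0 := (hdiff.differentiableAt hball).hasDerivAt
  -- `exp ∘ Lg = Z` on the ball
  have hexp : (fun ε => Complex.exp (Lg ε)) =ᶠ[𝓝 0] fun ε => polymerPartitionFunction polyInc (srcActivity G β U μ b₀ ε) B := by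
    filter_upwards [hball] with ε hε
    exact (isSmallActivity_srcActivity (U := U) (μ := μ) (b₀ := b₀) hdeg hβ0 hβ (le_of_lt (by simpa using hε))).exp_polymerLogZ B
  have hZ : HasDerivAt (fun ε => polymerPartitionFunction polyInc (srcActivity G β U μ b₀ ε) B) 0 0 :=
    hasDerivAt_polymerPartitionFunction_zero polyInc (v := fun ε A => srcActivity G β U μ b₀ ε A) hB
  have hexpL : HasDerivAt (fun ε => Complex.exp (Lg ε)) (Complex.exp (Lg 0) * deriv Lg 0) 0 := hL.cexp
  have huniq : Complex.exp (Lg 0) * deriv Lg 0 = 0 := (hexpL.congr_of_eventuallyEq hexp.symm).unique hZ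
  have hd : deriv Lg 0 = 0 := by
    rcases mul_eq_zero.1 huniq with h | h
    · exact absurd h (Complex.exp_ne_zero _)
    · exact h
  rwa [hd] at hL

/-- Hence the truncated functional of a family of small polymers has vanishing derivative at `0`.
[cite: KoteckyPreiss1986, (3)] -/
theorem hasDerivAt_truncatedWeight_srcActivity_zero [Countable Λ] (hdeg : ∀ v : Λ, (Finset.univ.filter (G.Adj v)).card ≤ 4)
    (hβ0 : 0 ≤ β) (hβ : β ≤ betaHT) {C : Finset (Finset Λ)}
    (hC : ∀ A ∈ C, HasDerivAt (fun ε : ℂ => srcActivity G β U μ b₀ ε A) 0 0) :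
    HasDerivAt (fun ε : ℂ => truncatedWeight polyInc (srcActivity G β U μ b₀ ε) C) 0 0 := by
  unfold truncatedWeight
  refine hasDerivAt_sum_zero fun B hB => ?_
  have h := (hasDerivAt_polymerLogZ_srcActivity_zero (U := U) (μ := μ) hdeg hβ0 hβ
    (fun A hA => hC A (Finset.mem_powerset.1 hB hA))).const_mul ((-1 : ℂ) ^ (C \ B).card)
  rwa [mul_zero] at h

/-- **The main part has no linear response when `R ≤ ht(ȳ) + 1`**: `main_R'(0) = 0`.
[cite: Ueltschi1999, proof of Thm. 2.1 (iii)] -/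
theorem hasDerivAt_srcMain_zero [Countable Λ] (hdeg : ∀ v : Λ, (Finset.univ.filter (G.Adj v)).card ≤ 4)
    (hβ0 : 0 ≤ β) (hβ : β ≤ betaHT) {ht : Λ → ℕ} (hlip : ∀ a b, G.Adj a b → ht b ≤ ht a + 1) (h0 : ht b₀.1 = 0)
    {R : ℕ} (hR : R ≤ ht b₀.2.1 + 1) :
    HasDerivAt (srcMain G β U μ b₀ R) 0 0 := by
  have h : srcMain G β U μ b₀ R = fun ε =>
      ∑ C ∈ (srcFamilies b₀).filter (fun C => famSize C < R), truncatedWeight polyInc (srcActivity G β U μ b₀ ε) C := by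
    funext ε; rfl
  rw [h]
  refine hasDerivAt_sum_zero fun C hC => ?_
  have hsize : famSize C < R := (Finset.mem_filter.1 hC).2
  refine hasDerivAt_truncatedWeight_srcActivity_zero hdeg hβ0 hβ fun A hA => hasDerivAt_srcActivity_zero hlip h0 ?_
  have hle : A.card ≤ famSize C := Finset.single_le_sum (f := fun A : Finset Λ => A.card) (fun _ _ => Nat.zero_le _) hA
  omega

/-- The tail is differentiable on `|ε| < β₀`. [cite: KoteckyPreiss1986, p. 493 (analyticity of log Z)] -/
theorem differentiableOn_srcTail [Countable Λ] (hdeg : ∀ v : Λ, (Finset.univ.filter (G.Adj v)).card ≤ 4)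
    (hβ0 : 0 ≤ β) (hβ : β ≤ betaHT) (R : ℕ) :
    DifferentiableOn ℂ (srcTail G β U μ b₀ R) (Metric.ball 0 betaHT) := by
  have h : srcTail G β U μ b₀ R = fun ε =>
      ∑ C ∈ (srcFamilies b₀).filter (fun C => R ≤ famSize C), truncatedWeight polyInc (srcActivity G β U μ b₀ ε) C := by
    funext ε; rfl
  rw [h]
  refine DifferentiableOn.fun_sum fun C _ => ?_
  unfold truncatedWeight
  refine DifferentiableOn.fun_sum fun B _ => DifferentiableOn.const_mul ?_ _
  exact differentiableOn_polymerLogZ_param (inc := polyInc) (v := fun ε A => srcActivity G β U μ b₀ ε A) B Metric.isOpen_ball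
    (fun A _ => (differentiable_srcActivity A).differentiableOn) fun ε hε u hu =>
      polymerPartitionFunction_ray_ne_zero hdeg hβ0 hβ (le_of_lt (by simpa using hε)) hu _

/-- **`F'(0) = tail_R'(0)` for `R ≤ ht(ȳ) + 1`**, with the Cauchy bound `|tail_R'(0)| ≤ 2e^{-R}/(β₀/2)`:
hence `|F'(0)| ≤ 4 e^{-R} / β₀`. [cite: Ueltschi1999, proof of Thm. 2.1 (iii)] -/
theorem norm_deriv_srcLogZ_le [Countable Λ] (hdeg : ∀ v : Λ, (Finset.univ.filter (G.Adj v)).card ≤ 4)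
    (hβ0 : 0 ≤ β) (hβ : β ≤ betaHT) {ht : Λ → ℕ} (hlip : ∀ a b, G.Adj a b → ht b ≤ ht a + 1) (h0 : ht b₀.1 = 0)
    {R : ℕ} (hR : R ≤ ht b₀.2.1 + 1) :
    ‖deriv (srcLogZ G β U μ b₀) 0‖ ≤ 4 * Real.exp (-R) / betaHT := by
  have hr : 0 < betaHT / 2 := half_pos betaHT_pos
  have hball : Metric.ball (0 : ℂ) betaHT ∈ 𝓝 (0 : ℂ) := Metric.ball_mem_nhds 0 betaHT_pos
  have hTd : DifferentiableOn ℂ (fun ε => srcTail G β U μ b₀ R ε - srcTail G β U μ b₀ R 0) (Metric.ball 0 betaHT) :=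
    (differentiableOn_srcTail hdeg hβ0 hβ R).sub (differentiableOn_const _)
  -- `F ε = F 0 + (main ε - main 0) + (tail ε - tail 0)`
  have hFeq : srcLogZ G β U μ b₀ = fun ε => srcLogZ G β U μ b₀ 0 +
      (srcMain G β U μ b₀ R ε - srcMain G β U μ b₀ R 0) + (srcTail G β U μ b₀ R ε - srcTail G β U μ b₀ R 0) := by
    funext ε
    have := srcLogZ_sub_eq_main_add_tail (G := G) (β := β) (U := U) (μ := μ) (b₀ := b₀) R ε 0
    linear_combination this
  have hmain : HasDerivAt (fun ε => srcMain G β U μ b₀ R ε - srcMain G β U μ b₀ R 0) 0 0 :=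
    (hasDerivAt_srcMain_zero (U := U) (μ := μ) hdeg hβ0 hβ hlip h0 hR).sub_const (srcMain G β U μ b₀ R 0)
  have hT0 : HasDerivAt (fun ε => srcTail G β U μ b₀ R ε - srcTail G β U μ b₀ R 0)
      (deriv (fun ε => srcTail G β U μ b₀ R ε - srcTail G β U μ b₀ R 0) 0) 0 := (hTd.differentiableAt hball).hasDerivAt
  have hF0 : HasDerivAt (srcLogZ G β U μ b₀) (deriv (fun ε => srcTail G β U μ b₀ R ε - srcTail G β U μ b₀ R 0) 0) 0 := by
    rw [hFeq]
    have := (hmain.const_add (srcLogZ G β U μ b₀ 0)).add hT0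
    rwa [zero_add] at this
  rw [hF0.deriv]
  -- Cauchy estimate for the tail increment on `|ε| = β₀/2`
  have hclosed : Metric.closedBall (0 : ℂ) (betaHT / 2) ⊆ Metric.ball 0 betaHT :=
    Metric.closedBall_subset_ball (by linarith [betaHT_pos])
  have hdiff : DiffContOnCl ℂ (fun ε => srcTail G β U μ b₀ R ε - srcTail G β U μ b₀ R 0) (Metric.ball 0 (betaHT / 2)) :=
    hTd.diffContOnCl_ball hclosed
  have hbound : ∀ z ∈ Metric.sphere (0 : ℂ) (betaHT / 2), ‖srcTail G β U μ b₀ R z - srcTail G β U μ b₀ R 0‖ ≤ 2 * Real.exp (-R) := by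
    intro z hz
    have hz' : ‖z‖ ≤ betaHT := by
      rw [mem_sphere_zero_iff_norm] at hz
      rw [hz]; linarith [betaHT_pos]
    have h0' : ‖(0 : ℂ)‖ ≤ betaHT := by rw [norm_zero]; exact betaHT_pos.le
    calc ‖srcTail G β U μ b₀ R z - srcTail G β U μ b₀ R 0‖ ≤ ‖srcTail G β U μ b₀ R z‖ + ‖srcTail G β U μ b₀ R 0‖ := norm_sub_le _ _
      _ ≤ Real.exp (-R) + Real.exp (-R) :=
          add_le_add (norm_srcTail_le (U := U) (μ := μ) hdeg hβ0 hβ hz' R) (norm_srcTail_le (U := U) (μ := μ) hdeg hβ0 hβ h0' R)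
      _ = 2 * Real.exp (-R) := by ring
  calc ‖deriv (fun ε => srcTail G β U μ b₀ R ε - srcTail G β U μ b₀ R 0) 0‖
      ≤ 2 * Real.exp (-R) / (betaHT / 2) := Complex.norm_deriv_le_of_forall_mem_sphere_norm_le hr hdiff hbound
    _ = 4 * Real.exp (-R) / betaHT := by
        have hb : betaHT ≠ 0 := betaHT_pos.ne'
        field_simp
        ring

end Generic

/-! ### The torus: exponential decay in the torus distance -/

section Torus

variable {β U μ : ℝ}

/-- The torus distance to `0̄` grows by at most one along an edge. [folklore] -/
theorem tnorm_le_succ_of_adj {L : ℕ} [NeZero L] {u v : FermionTorus 2 L} (h : (fermionTorusGraph 2 L).Adj u v) :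
    Torus.tnorm v.toTorusSite ≤ Torus.tnorm u.toTorusSite + 1 := by
  rw [fermionTorusGraph_adj] at h
  have h1 := Torus.tnorm_sub_le_succ_of_adj h 0
  rwa [sub_zero, sub_zero] at h1

/-- **Exponential decay of the equal-spin two-point function from `0̄` in the torus distance**:
`|⟨c†_{0̄σ} c_{ȳσ}⟩_{β,L}| ≤ (4/β₀) e^{-(d_L(ȳ) + 1)}` for `0 ≤ β ≤ β₀`, all real `U, μ`, all `L ≥ 1`.
[cite: Ueltschi1999, Thm. 2.1 (iii)] -/
theorem norm_hubbardThermalTwoPoint_zero_le (hβ0 : 0 ≤ β) (hβ : β ≤ betaHT) (U μ : ℝ) {L : ℕ} [NeZero L] (y : Site 2) (σ : Fin 2) :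
    ‖hubbardThermalTwoPoint β U μ L 0 y σ σ‖ ≤ 4 * Real.exp (-(Torus.tnorm (Torus.proj L y) + 1 : ℕ)) / betaHT := by
  rw [← deriv_srcLogZ_torus y σ hβ0 hβ]
  refine norm_deriv_srcLogZ_le (U := U) (μ := μ) (degree_torus_le L) hβ0 hβ (ht := fun u => Torus.tnorm u.toTorusSite)
    (fun a b hab => tnorm_le_succ_of_adj hab) ?_ (le_of_eq ?_)
  · show Torus.tnorm (torusPt L 0).toTorusSite = 0
    rw [toTorusSite_torusPt, show Torus.proj L (0 : Site 2) = 0 by funext i; simp, tnorm_zero]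
  · show Torus.tnorm (Torus.proj L y) + 1 = Torus.tnorm (torusPt L y).toTorusSite + 1
    rw [toTorusSite_torusPt]

/-- **Exponential decay of the two-point function at high temperature** (all sites and spins):
`|⟨c†_{xσ} c_{yσ'}⟩_{β,L}| ≤ (4/β₀) e^{-(d_L(y - x) + 1)}`, `d_L` the sup-norm distance on the torus of
side `L ≥ 1`, for `0 ≤ β ≤ β₀` and all real `U, μ`. [cite: Ueltschi1999, Thm. 2.1 (iii)] -/
theorem norm_hubbardThermalTwoPoint_le_exp_neg (hβ0 : 0 ≤ β) (hβ : β ≤ betaHT) (U μ : ℝ) {L : ℕ} [NeZero L]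
    (x y : Site 2) (σ σ' : Fin 2) :
    ‖hubbardThermalTwoPoint β U μ L x y σ σ'‖ ≤ 4 * Real.exp (-(Torus.tnorm (Torus.proj L (y - x)) + 1 : ℕ)) / betaHT := by
  by_cases hσ : σ = σ'
  · subst hσ
    rw [hubbardThermalTwoPoint_eq_sub]
    exact norm_hubbardThermalTwoPoint_zero_le hβ0 hβ U μ (y - x) σ
  · rw [hubbardThermalTwoPoint_eq_zero_of_ne β U μ L x y hσ, norm_zero]
    exact div_nonneg (mul_nonneg (by norm_num) (Real.exp_pos _).le) betaHT_pos.le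

/-- For `L > 2‖z‖_∞` the torus distance of `z̄` to `0̄` is `‖z‖_∞`. [folklore] -/
theorem tnorm_proj_eq_supNorm {L : ℕ} [NeZero L] {z : Site 2} (hL : 2 * Site.supNorm z < L) :
    Torus.tnorm (Torus.proj L z) = Site.supNorm z := by
  unfold Torus.tnorm
  rw [Torus.cRep_proj_of_mem_box hL (mem_box_iff_supNorm_le.2 le_rfl)]

end Torus

end SourceGas

/-- **Exponential decay of the infinite-volume two-point function at high temperature**: for
`0 ≤ β ≤ β₀ = SourceGas.betaHT` and all real `U, μ`, every limit `S` of `⟨c†_{xσ} c_{yσ'}⟩_{β,L}` as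
`L → ∞` (they exist: `exists_tendsto_hubbardThermalTwoPoint_of_le_betaHT`) obeys
`|S| ≤ (4/β₀) e^{-(‖y - x‖_∞ + 1)}`. [cite: Ueltschi1999, Thm. 2.1 (iii)] -/
theorem norm_lim_hubbardThermalTwoPoint_le_exp_neg {β : ℝ} (hβ0 : 0 ≤ β) (hβ : β ≤ SourceGas.betaHT) (U μ : ℝ)
    (x y : Site 2) (σ σ' : Fin 2) {S : ℂ} (hS : Tendsto (fun L : ℕ => hubbardThermalTwoPoint β U μ L x y σ σ') atTop (𝓝 S)) :
    ‖S‖ ≤ 4 * Real.exp (-(Site.supNorm (y - x) + 1 : ℕ)) / SourceGas.betaHT := by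
  refine le_of_tendsto hS.norm (Filter.eventually_atTop.2 ⟨2 * Site.supNorm (y - x) + 1, fun L hL => ?_⟩)
  haveI : NeZero L := ⟨by omega⟩
  have h := SourceGas.norm_hubbardThermalTwoPoint_le_exp_neg hβ0 hβ U μ (L := L) x y σ σ'
  rwa [SourceGas.tnorm_proj_eq_supNorm (by omega)] at h

end Literature.MathematicalPhysics.QuantumLattice

end
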